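import Summits.BirchSwinnertonDyer.BirchSwinnertonDyer.Theorems.AlignedTransportAtTwoBSDOfMainConjectureRankOneAtTwoSigmaSqTwoVeluFormal
import Literature.NumberTheory.EllipticCurves.FormalGroupLogHomProofs
import HarnessLib

/-!
# Vélu's `2`-isogeny on the formal group: **the invariant differential is preserved**, `ω'(τ)·dτ = ω`, hence
# `log_{V'}(τ) = log_V` — the hypothesis `hlog` of the squared `2`-isogeny functional equation (Vélu model, `π = 1`);
# step S4 of the discharge plan for the PRINT stub `stub_sigmaSqTwo` of crux C3′ (route-independent)

Cell `bsd-f1-sign2`, WIDTH-5 attach seat `bsd-line-att-p3` g8 (`--supports stmt-BirchSwinnertonDyer-23008`; plan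
`Cruxes/BSDOfMainConjectureRankOneAtTwo/SIGMASQ-AT-TWO-att-p3.md`). THEOREMS ONLY; sequel of `…SigmaSqTwoVeluFormal.lean` (notation
`A = X − ez²`, `M = XA + tz⁴`, `Dn = XA² + tz⁴(a₁zA − X − fz³)`, `u = Dn⁻¹`, `τ = zAMu = ψ*z'`, `P = AM³u² = X_{V'}(τ)`).
BSD is not proved by any of this.

* `velu_two_sq_eq` — the cleared equation `P² = P³ + a₁τP² + a₂τ²P² + a₃τ³P + A₄τ⁴P + A₆τ⁶` (from `velu_two_formal_key`).
* `velu_two_dx_relation` — **`dξ = (1 − t/(x−e)²)dx` cleared**: `(τP^• − 2Pτ^•)·z³A² = (A² − tz⁴)(zX^• − 2X)·τ³` (pure calculus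
  from `P·z²A = τ²M` and its derivative).
* `velu_two_negY_formal` — **`2υ + a₁ξ + a₃ = (1 − t/(x−e)²)(2y + a₁x + a₃)` cleared**: `((a₁τ − 2)P + a₃τ³)·A² = (A² − tz⁴)·Ỹ·(AMu)³`,
  `Ỹ = (a₁z − 2)X + a₃z³` (uses `2f + a₁e + a₃ = 0`).
* `velu_two_formalInvDiff_subst` — **`ω_{V'}(τ)·τ^• = ω_V`** (`ψ*ω' = ω`, Vélu's normalisation), in any commutative DOMAIN with `2 ≠ 0`
  (the chart lemma `formalEta_subst_mul_eq` is divided by `τP^• − 2Pτ^• = −2 + O(z)`; at `p = 2` this is not a unit, only a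
  non-zero-divisor).
* `velu_two_formalLog_subst` — over a `ℚ`-algebra domain: **`log_{V'}(τ) = log_V`** (`π = 1`); for the Frobenius-compatible model
  `V'' = [2; r, ½, −r/2]·V'` the tree's `formalVariableChange` turns this into `log_{V''}(τ'') = 2·log_V`, the `hlog` (`π = 2`) of
  `X_sq_mul_sq_subst_eq_of_twoIsogeny`.

## Sources
* J. Vélu, C. R. Acad. Sci. Paris 273 (1971) (`ψ*(dx'/(2y' + a₁x' + a₃)) = dx/(2y + a₁x + a₃)`). [cite: SilvermanAEC2009, III.4]
* C. Blakestad, D. Grant, J. Number Theory 249 (2023), Prop. 7 (c), Prop. 13 (`ω'(T')dT' = πω`). [cite: BlakestadGrant2023, Prop. 7]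
* J. H. Silverman, *AEC* 2nd ed., IV.1 (`ω = dx/(2y + a₁x + a₃) = (1 + ⋯)dz`), IV.4–IV.5 (`log`). [cite: SilvermanAEC2009, IV.1.1]
-/

noncomputable section

set_option linter.dupNamespace false
set_option autoImplicit false

open scoped Classical
open PowerSeries WeierstrassCurve Literature.NumberTheory.EllipticCurves

namespace Summit.BirchSwinnertonDyer.BirchSwinnertonDyer.Theorems.AlignedTransportAtTwoSigmaSqTwo

section AnyRing

variable {R : Type*} [CommRing R] (V : WeierstrassCurve R)

/-- **The cleared Weierstrass equation of `(τ, P)` on Vélu's curve**: `P² = P³ + a₁τP² + a₂τ²P² + a₃τ³P + A₄τ⁴P + A₆τ⁶`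
(`A₄ = a₄ − 5t`, `A₆ = a₆ − b₂t − 7et`; hypothesis `heq` of the tree's chart lemmas). [cite: SilvermanAEC2009, IV.1.1] -/
theorem velu_two_sq_eq {e f t : R}
    (hQ : f ^ 2 + V.a₁ * e * f + V.a₃ * f = e ^ 3 + V.a₂ * e ^ 2 + V.a₄ * e + V.a₆)
    (h2 : 2 * f + V.a₁ * e + V.a₃ = 0) (ht : t = 3 * e ^ 2 + 2 * V.a₂ * e + V.a₄ - V.a₁ * f)
    {A M Dn u τ P : R⟦X⟧} (hA : A = V.formalXMulSq - C e * X ^ 2) (hM : M = V.formalXMulSq * A + C t * X ^ 4)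
    (hDn : Dn = V.formalXMulSq * A ^ 2 + C t * X ^ 4 * (C V.a₁ * X * A - V.formalXMulSq - C f * X ^ 3))
    (hu : Dn * u = 1) (hτ : τ = X * A * M * u) (hP : P = A * M ^ 3 * u ^ 2) :
    P ^ 2 = P ^ 3 + C V.a₁ * τ * P ^ 2 + C V.a₂ * τ ^ 2 * P ^ 2 + C V.a₃ * τ ^ 3 * P +
      (C V.a₄ - 5 * C t) * τ ^ 4 * P + (C V.a₆ - (C V.a₁ ^ 2 + 4 * C V.a₂) * C t - 7 * C e * C t) * τ ^ 6 := by
  have key := velu_two_formal_key V hQ h2 ht A M Dn hA hM hDn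
  subst hτ hP
  set L₁ := C V.a₁ * X * A * M + C V.a₃ * X ^ 3 * A ^ 2 with hL₁
  linear_combination (A ^ 2 * M ^ 6 * u ^ 6) * key + (-(A ^ 2 * M ^ 6 * u ^ 4 * (1 + u * Dn - u * L₁))) * hu

/-- `P·z²A = τ²·M` (`ξ = P/τ² = M/(z²A) = x + t/(x − e)`). [cite: SilvermanAEC2009, III.4] -/
theorem velu_two_P_mul {A M u τ P : R⟦X⟧} (hτ : τ = X * A * M * u) (hP : P = A * M ^ 3 * u ^ 2) :
    P * (X ^ 2 * A) = τ ^ 2 * M := by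
  subst hτ hP; ring

/-- **`dξ = (1 − t/(x − e)²)·dx`, cleared**: `(τP^• − 2Pτ^•)·z³A² = (A² − tz⁴)·(zX^• − 2X)·τ³` — pure calculus from
`P·z²A = τ²M`, its derivative, `A = X − ez²`, `M = XA + tz⁴`. [cite: SilvermanAEC2009, III.4] -/
theorem velu_two_dx_relation {e t : R} {A M u τ P : R⟦X⟧} (hA : A = V.formalXMulSq - C e * X ^ 2)
    (hM : M = V.formalXMulSq * A + C t * X ^ 4) (hτ : τ = X * A * M * u) (hP : P = A * M ^ 3 * u ^ 2) :
    (τ * d⁄dX R P - 2 * P * d⁄dX R τ) * X ^ 3 * A ^ 2 =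
      (A ^ 2 - C t * X ^ 4) * (X * d⁄dX R V.formalXMulSq - 2 * V.formalXMulSq) * τ ^ 3 := by
  set Xs := V.formalXMulSq with hXs
  have ha : P * (X ^ 2 * A) = τ ^ 2 * M := velu_two_P_mul hτ hP
  have hdA : d⁄dX R A = d⁄dX R Xs - 2 * C e * X := by
    rw [hA, map_sub, Derivation.leibniz, derivative_C, smul_zero, add_zero, Derivation.leibniz_pow, derivative_X]
    simp only [nsmul_eq_mul, smul_eq_mul, Nat.cast_ofNat, Nat.add_one_sub_one, pow_one]
    ring
  have hdM : d⁄dX R M = d⁄dX R Xs * A + Xs * d⁄dX R A + 4 * C t * X ^ 3 := by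
    rw [hM, map_add, Derivation.leibniz, Derivation.leibniz, derivative_C, smul_zero, add_zero, Derivation.leibniz_pow,
      derivative_X]
    simp only [nsmul_eq_mul, smul_eq_mul, Nat.cast_ofNat, Nat.add_one_sub_one]
    ring
  have hb : d⁄dX R P * (X ^ 2 * A) + P * (2 * X * A + X ^ 2 * d⁄dX R A) =
      d⁄dX R M * τ ^ 2 + 2 * M * τ * d⁄dX R τ := by
    have h := congrArg (d⁄dX R) ha
    rw [Derivation.leibniz, Derivation.leibniz, Derivation.leibniz, Derivation.leibniz_pow, Derivation.leibniz_pow,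
      derivative_X] at h
    simp only [nsmul_eq_mul, smul_eq_mul, Nat.cast_ofNat, Nat.add_one_sub_one, pow_one] at h
    linear_combination h
  set dP := d⁄dX R P with hdP
  set dτ := d⁄dX R τ with hdτ
  set dM := d⁄dX R M with hdM'
  set dA := d⁄dX R A with hdA'
  set dXs := d⁄dX R Xs with hdXs
  linear_combination (τ * X * A) * hb + (-(2 * dτ * X * A + τ * (2 * A + X * dA))) * ha + (τ ^ 3 * A * X) * hdM + (-(τ ^ 3 * M * X) + τ ^ 3 * A * Xs * X) * hdA + ((-2 : R⟦X⟧) * τ ^ 3 * A + -(τ ^ 3 * dXs * X) + (2 : R⟦X⟧) * τ ^ 3 * X ^ 2 * C e) * hM + ((2 : R⟦X⟧) * τ ^ 3 * X ^ 4 * C t) * hA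

/-- **`2υ + a₁ξ + a₃ = (1 − t/(x − e)²)(2y + a₁x + a₃)`, cleared**: `((a₁τ − 2)P + a₃τ³)·A² = (A² − tz⁴)·Ỹ·(AMu)³` with
`Ỹ = (a₁z − 2)X + a₃z³ = z³(2y + a₁x + a₃)` (`formalYTilde`). Uses `2f + a₁e + a₃ = 0` and `u·Dn = 1`. [cite: SilvermanAEC2009, III.4] -/
theorem velu_two_negY_formal {e f t : R} (h2 : 2 * f + V.a₁ * e + V.a₃ = 0)
    {A M Dn u τ P : R⟦X⟧} (hA : A = V.formalXMulSq - C e * X ^ 2) (hM : M = V.formalXMulSq * A + C t * X ^ 4)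
    (hDn : Dn = V.formalXMulSq * A ^ 2 + C t * X ^ 4 * (C V.a₁ * X * A - V.formalXMulSq - C f * X ^ 3))
    (hu : Dn * u = 1) (hτ : τ = X * A * M * u) (hP : P = A * M ^ 3 * u ^ 2) :
    ((C V.a₁ * τ - 2) * P + C V.a₃ * τ ^ 3) * A ^ 2 = (A ^ 2 - C t * X ^ 4) * V.formalYTilde * (A * M * u) ^ 3 := by
  have h2C : 2 * (C f : R⟦X⟧) + C V.a₁ * C e + C V.a₃ = 0 := by
    have := congrArg (C (R := R)) h2
    simpa only [map_add, map_mul, map_ofNat, map_zero] using this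
  rw [formalYTilde_def]
  subst hτ hP hDn hM hA
  linear_combination ((V.formalXMulSq - C e * X ^ 2) ^ 3 * (V.formalXMulSq * (V.formalXMulSq - C e * X ^ 2) + C t * X ^ 4) ^ 3 *
      u ^ 3 * C t * X ^ 7) * h2C +
    (2 * (V.formalXMulSq - C e * X ^ 2) ^ 3 * (V.formalXMulSq * (V.formalXMulSq - C e * X ^ 2) + C t * X ^ 4) ^ 3 * u ^ 2) * hu

end AnyRing

section Domain

variable {R : Type*} [CommRing R] [IsDomain R] (V : WeierstrassCurve R)

/-- **Vélu's normalisation on the formal group: `ω_{V'}(τ)·τ^• = ω_V`** (`ψ*ω' = ω`) for the `2`-isogeny with a `2`-torsion kernel,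
in any commutative domain with `2 ≠ 0`. Chart lemma for `V'` (`η'(τ)(τP^• − 2Pτ^•) = τ^•((a₁τ − 2)P + a₃τ³)`), `velu_two_negY_formal`,
`velu_two_dx_relation` and `η(zX^• − 2X) = Ỹ` on `V` give `(η'(τ) − ητ^•)·(τP^• − 2Pτ^•)·z³A² = 0`; the second factor is
`−2z³ + ⋯ ≠ 0`. [cite: BlakestadGrant2023, Prop. 7] [cite: SilvermanAEC2009, IV.1.1] -/
theorem velu_two_formalInvDiff_subst (htwo : (2 : R) ≠ 0) {e f t : R}
    (hQ : f ^ 2 + V.a₁ * e * f + V.a₃ * f = e ^ 3 + V.a₂ * e ^ 2 + V.a₄ * e + V.a₆)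
    (h2 : 2 * f + V.a₁ * e + V.a₃ = 0) (ht : t = 3 * e ^ 2 + 2 * V.a₂ * e + V.a₄ - V.a₁ * f)
    {A M Dn u τ P : R⟦X⟧} (hA : A = V.formalXMulSq - C e * X ^ 2) (hM : M = V.formalXMulSq * A + C t * X ^ 4)
    (hDn : Dn = V.formalXMulSq * A ^ 2 + C t * X ^ 4 * (C V.a₁ * X * A - V.formalXMulSq - C f * X ^ 3))
    (hu : Dn * u = 1) (hτ : τ = X * A * M * u) (hP : P = A * M ^ 3 * u ^ 2)
    (V' : WeierstrassCurve R) (h1' : V'.a₁ = V.a₁) (h2' : V'.a₂ = V.a₂) (h3' : V'.a₃ = V.a₃)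
    (h4' : V'.a₄ = V.a₄ - 5 * t) (h6' : V'.a₆ = V.a₆ - V.b₂ * t - 7 * e * t) :
    V'.formalInvDiff.subst τ * d⁄dX R τ = V.formalInvDiff := by
  -- constant terms
  have hA0 : constantCoeff A = 1 := by
    rw [hA, map_sub, map_mul, map_pow, constantCoeff_X, constantCoeff_formalXMulSq]; ring
  have hM0 : constantCoeff M = 1 := by
    rw [hM, map_add, map_mul, map_mul, map_pow, constantCoeff_X, constantCoeff_formalXMulSq, hA0]; ring
  have hDn0 : constantCoeff Dn = 1 := by
    rw [hDn, map_add, map_mul, map_mul, map_mul, map_pow, map_pow, constantCoeff_X, constantCoeff_formalXMulSq, hA0]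
    ring
  have hu0 : constantCoeff u = 1 := by
    have e1 := congrArg constantCoeff hu
    rw [map_mul, hDn0, one_mul, map_one] at e1
    exact e1
  have hτ0 : constantCoeff τ = 0 := by
    rw [hτ, map_mul, map_mul, map_mul, constantCoeff_X]; ring
  have hP0 : constantCoeff P = 1 := by
    rw [hP, map_mul, map_mul, map_pow, map_pow, hA0, hM0, hu0]; ring
  have hτ1 : coeff 1 τ = 1 := by
    rw [hτ, mul_assoc, mul_assoc, coeff_succ_X_mul, coeff_zero_eq_constantCoeff, map_mul, map_mul, hA0, hM0, hu0]
    ring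
  -- the chart lemma for V'
  have heq := velu_two_sq_eq V hQ h2 ht hA hM hDn hu hτ hP
  have heq' : P ^ 2 = P ^ 3 + C V'.a₁ * τ * P ^ 2 + C V'.a₂ * τ ^ 2 * P ^ 2 + C V'.a₃ * τ ^ 3 * P +
      C V'.a₄ * τ ^ 4 * P + C V'.a₆ * τ ^ 6 := by
    rw [h1', h2', h3', h4', h6', WeierstrassCurve.b₂]
    simp only [map_sub, map_mul, map_add, map_pow, map_ofNat]
    exact heq
  have hηlem := V'.formalEta_subst_mul_eq hτ0 hP0 heq'
  rw [h1', h3'] at hηlem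
  -- the three relations on V
  have hnegY := velu_two_negY_formal V h2 hA hM hDn hu hτ hP
  have hdx := velu_two_dx_relation V hA hM hτ hP
  have hVrel := V.formalEta_mul_sub_eq_formalYTilde
  have hτ3 : τ ^ 3 = X ^ 3 * (A * M * u) ^ 3 := by rw [hτ]; ring
  -- (eta'(tau) - eta * dtau) * Q = 0 with Q = (tau P' - 2 P tau') z^3 A^2
  set Q₁ := τ * d⁄dX R P - 2 * P * d⁄dX R τ with hQ₁
  have hprod : (V'.formalEta.subst τ - V.formalEta * d⁄dX R τ) * (Q₁ * X ^ 3 * A ^ 2) = 0 := by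
    linear_combination (X ^ 3 * A ^ 2) * hηlem + (d⁄dX R τ * X ^ 3) * hnegY -
      (V.formalEta * d⁄dX R τ) * hdx - (d⁄dX R τ * X ^ 3 * (A ^ 2 - C t * X ^ 4) * (A * M * u) ^ 3) * hVrel -
      (V.formalEta * d⁄dX R τ * (A ^ 2 - C t * X ^ 4) * (X * d⁄dX R V.formalXMulSq - 2 * V.formalXMulSq)) * hτ3
  -- the second factor is nonzero
  have hQ0 : constantCoeff Q₁ = -2 := by
    rw [hQ₁, map_sub, map_mul, hτ0, zero_mul, map_mul, map_mul, hP0, ← coeff_zero_eq_constantCoeff_apply (d⁄dX R τ),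
      coeff_derivative, zero_add, hτ1]
    have h2c : constantCoeff (2 : R⟦X⟧) = 2 := map_ofNat constantCoeff 2
    rw [h2c]; norm_num
  have hQne : Q₁ * X ^ 3 * A ^ 2 ≠ 0 := by
    refine mul_ne_zero (mul_ne_zero ?_ (pow_ne_zero _ X_ne_zero)) (pow_ne_zero _ ?_)
    · intro h; rw [h, map_zero] at hQ0
      exact htwo (by linear_combination hQ0)
    · intro h; rw [h, map_zero] at hA0; exact zero_ne_one hA0
  have hη : V'.formalEta.subst τ = V.formalEta * d⁄dX R τ :=
    sub_eq_zero.mp ((mul_eq_zero.mp hprod).resolve_right hQne)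
  -- invert: omega is the inverse of eta
  have hsT : HasSubst τ := HasSubst.of_constantCoeff_zero' hτ0
  have hηW' : V'.formalEta.subst τ * V'.formalInvDiff.subst τ = 1 := by
    rw [← subst_mul hsT, V'.formalEta_mul_formalInvDiff]
    rw [show (1 : R⟦X⟧) = C (1 : R) from (map_one C).symm, subst_C]; rfl
  have hηW := V.formalEta_mul_formalInvDiff
  linear_combination (-(V'.formalInvDiff.subst τ * V.formalInvDiff)) * hη +
    V.formalInvDiff * hηW' - (V'.formalInvDiff.subst τ * d⁄dX R τ) * hηW

end Domain

section RatAlgebra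

variable {R : Type*} [CommRing R] [IsDomain R] [Algebra ℚ R] (V : WeierstrassCurve R)

/-- **`log_{V'}(τ) = log_V`** (Vélu model, `π = 1`): the hypothesis `hlog` of the squared `2`-isogeny functional equation, over any
`ℚ`-algebra domain (`ℚ_p`, `Frac R̂₂`). From `ω'(τ)τ^• = ω`: both sides have derivative `ω` and vanish at `0`.
[cite: BlakestadGrant2023, Prop. 7] [cite: SilvermanAEC2009, IV.5] -/
theorem velu_two_formalLog_subst {e f t : R}
    (hQ : f ^ 2 + V.a₁ * e * f + V.a₃ * f = e ^ 3 + V.a₂ * e ^ 2 + V.a₄ * e + V.a₆)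
    (h2 : 2 * f + V.a₁ * e + V.a₃ = 0) (ht : t = 3 * e ^ 2 + 2 * V.a₂ * e + V.a₄ - V.a₁ * f)
    {A M Dn u τ P : R⟦X⟧} (hA : A = V.formalXMulSq - C e * X ^ 2) (hM : M = V.formalXMulSq * A + C t * X ^ 4)
    (hDn : Dn = V.formalXMulSq * A ^ 2 + C t * X ^ 4 * (C V.a₁ * X * A - V.formalXMulSq - C f * X ^ 3))
    (hu : Dn * u = 1) (hτ : τ = X * A * M * u) (hP : P = A * M ^ 3 * u ^ 2)
    (V' : WeierstrassCurve R) (h1' : V'.a₁ = V.a₁) (h2' : V'.a₂ = V.a₂) (h3' : V'.a₃ = V.a₃)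
    (h4' : V'.a₄ = V.a₄ - 5 * t) (h6' : V'.a₆ = V.a₆ - V.b₂ * t - 7 * e * t) :
    V'.formalLog.subst τ = V.formalLog := by
  have htwo : (2 : R) ≠ 0 := by
    rw [← map_ofNat (algebraMap ℚ R) 2]
    exact (map_ne_zero_iff _ (algebraMap ℚ R).injective).mpr two_ne_zero
  have hω := velu_two_formalInvDiff_subst V htwo hQ h2 ht hA hM hDn hu hτ hP V' h1' h2' h3' h4' h6'
  have hτ0 : constantCoeff τ = 0 := by
    have hA0 : constantCoeff A = 1 := by
      rw [hA, map_sub, map_mul, map_pow, constantCoeff_X, constantCoeff_formalXMulSq]; ring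
    rw [hτ, map_mul, map_mul, map_mul, constantCoeff_X]; ring
  have hs : HasSubst τ := HasSubst.of_constantCoeff_zero' hτ0
  -- equal derivatives
  have hd : d⁄dX R (V'.formalLog.subst τ) = d⁄dX R V.formalLog := by
    rw [derivative_subst R hs, WeierstrassCurve.derivative_formalLog, WeierstrassCurve.derivative_formalLog,
      ← formalInvDiff_eq_formalOmega, ← formalInvDiff_eq_formalOmega]
    exact hω
  -- equal constant terms (both 0), hence equal
  ext n
  rcases n with _ | n
  · rw [coeff_zero_eq_constantCoeff, Literature.RingTheory.FormalGroups.constantCoeff_subst_of_constantCoeff_eq_zero hτ0,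
      constantCoeff_formalLog, constantCoeff_formalLog]
  · have e := congrArg (coeff n) hd
    rw [coeff_derivative, coeff_derivative] at e
    have hn : ((n : R) + 1) ≠ 0 := by
      rw [show ((n : R) + 1) = algebraMap ℚ R ((n : ℚ) + 1) by simp]
      intro h
      have : ((n : ℚ) + 1) = 0 := (algebraMap ℚ R).injective (by rw [h, map_zero])
      linarith [Nat.cast_nonneg (α := ℚ) n]
    exact mul_right_cancel₀ hn e

end RatAlgebra

end Summit.BirchSwinnertonDyer.BirchSwinnertonDyer.Theorems.AlignedTransportAtTwoSigmaSqTwo
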